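import Literature.NumberTheory.Automorphic.CuspidalRepDataOfCuspFormInfChar
import Literature.NumberTheory.Automorphic.GL2ZFiniteOfEigenfunction
import Literature.NumberTheory.Automorphic.GL2CasimirParameter
import HarnessLib

/-!
# `GL₂/ℚ`: the archimedean (Harish-Chandra) parameter of the cuspidal datum generated by a
# Casimir eigenform (Gelbart 1975, Thm. 5.19; Bump 1997, Thm. 2.7.1; Knapp 2002, Thm. 5.44)

Topic `NumberTheory/Automorphic`; theorems only (no definition, no named fact). The dictionary step
"cusp form `φ` on `GL₂(𝔸_ℚ)` with Casimir eigenvalue `s₁² + s₂² - ½` and central eigenvalue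
`s₁ + s₂` along `ι_𝔸 : GL₂(ℝ) → GL₂(𝔸_ℚ)` ↦ the cuspidal automorphic representation GENERATED by `φ`
has archimedean parameter `{s₁, s₂}`" (`AutomorphicRepData.HasArchParameter`), in the direction
`f ↦ π` of Gelbart's dictionary (holomorphic weight `k`: `{(k-1)/2, (1-k)/2}`; Maass: `{s, -s}`).
It combines the `Z(𝔤)`-character of such a `φ` (`Rat.hasZCharacter_of_casimir_of_zed`), the
infinitesimal character of the generated datum BY CYCLICITY
(`CuspidalAutomorphicRepData.hasInfinitesimalCharacter_lieRep_ofCuspForm` — no Schur lemma, no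
admissibility), the pull-back of central characters to the real place factor
(`HasCentralCharacter.exists_comp`, `lift_realPlaceLie_mem_center`) and the converse Casimir
computation `GL2Casimir.hasHCParameter_of_lift_casimir_of_lift_zed`; this is the weight-one bridge of
`GL2AdelicWeightVectors` (`sum_lieDeriv_single_sub_smul_mem`, direction `π ↦ φ`) read backwards.

* `AutomorphicRepData.mkQ_ne_zero_of_not_mem` — `[φ] ≠ 0` for `φ ∈ W ∖ W'`;
* `AutomorphicRepData.hasArchParameter_of_hasInfinitesimalCharacter_of_casimir_of_zed` — a
  `GL₂(𝔸_ℚ)`-datum whose Lie action has an infinitesimal character and which contains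
  `φ ∈ W ∖ W'` with the two eigen-equations has archimedean parameter `{s₁, s₂}`;
* `CuspidalAutomorphicRepData.hasArchParameter_ofCuspForm_of_casimir_of_zed` — the generated datum
  of such a cusp form has archimedean parameter `{s₁, s₂}`.

## References

* S. Gelbart, *Automorphic forms on adele groups* (1975), §4 and Thm. 5.19. [Gelbart1975]
* D. Bump, *Automorphic Forms and Representations* (1997), §2.2, Thm. 2.7.1, Thm. 3.6.1. [Bump1997]
* A. W. Knapp, *Lie Groups Beyond an Introduction* (2002), Prop. 5.32, Thm. 5.44. [Knapp2002]
* R. P. Langlands, Corvallis 1979, proof of Prop. 2. [LanglandsCorvallis1979Notion]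
-/

-- Mathlib idiom (Mathlib/Algebra/Lie/OfAssociative.lean): the commutator bracket on associative algebras.
attribute [local instance 100] LieRing.ofAssociativeRing

noncomputable section

open scoped MatrixGroups Matrix Classical
open NumberField NumberField.mixedEmbedding IsDedekindDomain UniversalEnvelopingAlgebra

namespace Literature.NumberTheory.Automorphic

/-! ### `GL₂/ℚ`: the archimedean parameter of the datum generated by a Casimir eigenform -/

section GL2Rat

variable {hcpt : isCompact_glFiniteIntegralLevel 2 ℚ}

open GL2Real GLnCasimir HCSpan

/-- The class of `φ ∈ W ∖ W'` in `W / W'` is non-zero. [folklore] -/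
theorem AutomorphicRepData.mkQ_ne_zero_of_not_mem {n : ℕ} {K : Type} [Field K] [NumberField K]
    {hcpt : isCompact_glFiniteIntegralLevel n K} (π : AutomorphicRepData (AutomorphyDatum.gl n K hcpt))
    {φ : (AdelicGroupData.gl n K).Adelic → ℂ} (hφ : φ ∈ π.W) (hφ' : φ ∉ π.W') :
    π.mkQ ⟨φ, hφ⟩ ≠ 0 := by
  intro h
  rw [Submodule.mkQ_apply, Submodule.Quotient.mk_eq_zero] at h
  exact hφ' h

set_option maxHeartbeats 800000 in
/-- **The Harish-Chandra parameter at the real place of a `GL₂(𝔸_ℚ)`-datum with infinitesimal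
character, read off one vector.** Let `π = W / W'` be an automorphic representation datum of
`GL₂(𝔸_ℚ)` whose Lie action `π.lieRep` has an infinitesimal character, and let `φ ∈ W ∖ W'` satisfy,
along `ι_𝔸 : GL₂(ℝ) → GL₂(𝔸_ℚ)`, `∑_{a,b} E_{ab}(E_{ba} φ) = (s₁² + s₂² - ½) φ` and `Z φ = (s₁ + s₂) φ`.
Then `π` has archimedean parameter `{s₁, s₂}`: the restriction of `π.lieRep` to the (unique, real)
place factor `𝔤𝔩₂(ℝ)` has a central character (`HasCentralCharacter.exists_comp`,
`lift_realPlaceLie_mem_center`), the Casimir and `Z` act on the non-zero class `[φ]` by the two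
scalars (`ρ(X)[ψ] = [Xψ]`, `Rat.topEquiv_symm_realPlaceLie`, `Rat.lieDeriv_ofArch_lieOfReal_eq`), and
`GL2Casimir.hasHCParameter_of_lift_casimir_of_lift_zed` identifies the parameter; `ℚ` has no complex
place. Knapp 2002, Thm. 5.44 with Prop. 5.32; Bump 1997, §2.2.
[cite: Knapp2002, §V.5 Thm. 5.44 and Prop. 5.32] [cite: Bump1997, §2.2] -/
theorem AutomorphicRepData.hasArchParameter_of_hasInfinitesimalCharacter_of_casimir_of_zed
    (π : AutomorphicRepData (AutomorphyDatum.gl 2 ℚ hcpt))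
    {θ : centerU (AutomorphyDatum.gl 2 ℚ hcpt).arch →ₐ[ℝ] ℂ}
    (hθ : Automorphic.HasInfinitesimalCharacter π.lieRep θ)
    {φ : (AdelicGroupData.gl 2 ℚ).Adelic → ℂ} (hφ : φ ∈ π.W) (hφ' : φ ∉ π.W') {s₁ s₂ : ℂ}
    (hC : (∑ a : Fin 2, ∑ b : Fin 2, lieDeriv Rat.iotaA (toLie (Matrix.single a b (1 : ℝ)))
        (lieDeriv Rat.iotaA (toLie (Matrix.single b a (1 : ℝ))) φ)) = (s₁ ^ 2 + s₂ ^ 2 - 1 / 2) • φ)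
    (hZ : lieDeriv Rat.iotaA (toLie 1) φ = (s₁ + s₂) • φ) :
    π.HasArchParameter fun _ => ({s₁, s₂} : Multiset ℂ) := by
  classical
  haveI := Rat.isEmpty_isComplex_infinitePlace
  refine ⟨π.lieRep, π.hasLieAction_lieRep, fun w => ?_, fun w => isEmptyElim w⟩
  -- the place factor `ρ' = π.lieRep ∘ topEquiv⁻¹ ∘ realPlaceLie`
  set ρ' : Matrix (Fin 2) (Fin 2) ℝ →ₗ⁅ℝ⁆ Module.End ℂ π.Quot :=
    (π.lieRep.comp (LieSubalgebra.topEquiv :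
      (⊤ : LieSubalgebra ℝ (Matrix (Fin 2) (Fin 2) (mixedSpace ℚ))) ≃ₗ⁅ℝ⁆
        Matrix (Fin 2) (Fin 2) (mixedSpace ℚ)).symm.toLieHom).comp (realPlaceLie 2 w) with hρ'
  -- its central character
  have hθc : HasCentralCharacter π.lieRep θ := (hasInfinitesimalCharacter_iff_hasCentralCharacter _ θ).1 hθ
  obtain ⟨θ₁, hθ₁⟩ := hθc.exists_comp
    (LieHom.comp (LieSubalgebra.topEquiv :
      (⊤ : LieSubalgebra ℝ (Matrix (Fin 2) (Fin 2) (mixedSpace ℚ))) ≃ₗ⁅ℝ⁆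
        Matrix (Fin 2) (Fin 2) (mixedSpace ℚ)).symm.toLieHom (realPlaceLie 2 w))
    (fun z hz => lift_realPlaceLie_mem_center w hz)
  have hθ₁' : HasCentralCharacter ρ' θ₁ := hθ₁
  -- the action of generators on classes: `ρ' X [ψ] = [X ψ]` along `ι_𝔸`
  have hact : ∀ (X : Matrix (Fin 2) (Fin 2) ℝ) (ψ : π.W),
      ρ' X (π.mkQ ψ) = π.mkQ (π.lieDerivW (Rat.lieOfReal hcpt X) ψ) := by
    intro X ψ
    change π.lieRep ((LieSubalgebra.topEquiv : (⊤ : LieSubalgebra ℝ (Matrix (Fin 2) (Fin 2) (mixedSpace ℚ))) ≃ₗ⁅ℝ⁆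
        Matrix (Fin 2) (Fin 2) (mixedSpace ℚ)).symm (realPlaceLie 2 w X)) (π.mkQ ψ) = _
    rw [Rat.topEquiv_symm_realPlaceLie]
    exact π.lieRep_mkQ _ _
  have hcoe : ∀ (X : Matrix (Fin 2) (Fin 2) ℝ) (ψ : π.W),
      ((π.lieDerivW (Rat.lieOfReal hcpt X) ψ : π.W) : (AdelicGroupData.gl 2 ℚ).Adelic → ℂ) =
        lieDeriv Rat.iotaA (toLie X) ψ := fun X ψ => by
    change lieDeriv (AutomorphyDatum.gl 2 ℚ hcpt).ofArch (Rat.lieOfReal hcpt X) ψ = _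
    rw [Rat.lieDeriv_ofArch_lieOfReal_eq]
  set v : π.Quot := π.mkQ ⟨φ, hφ⟩ with hv
  have hv0 : v ≠ 0 := π.mkQ_ne_zero_of_not_mem hφ hφ'
  -- `Z v = (s₁ + s₂) v`
  have hZ' : lift ℝ ρ' (zed 2) v = (s₁ + s₂) • v := by
    have h1 : lift ℝ ρ' (zed 2) v = ρ' 1 v := by
      change lift ℝ ρ' (UniversalEnvelopingAlgebra.ι ℝ (1 : Matrix (Fin 2) (Fin 2) ℝ)) v = _
      rw [lift_ι_apply]
    rw [h1, hv, hact, ← map_smul]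
    congr 1
    apply Subtype.ext
    rw [hcoe, Submodule.coe_smul, hZ]
  -- `C v = (s₁² + s₂² - ½) v`
  have hC' : lift ℝ ρ' (casimir 2) v = (s₁ ^ 2 + s₂ ^ 2 - 1 / 2) • v := by
    rw [casimir_eq_sum]
    simp only [map_sum, LinearMap.sum_apply, GL2Casimir.lift_ιU_mul_ιU_apply]
    rw [hv]
    simp only [hact]
    have hsum : (∑ a : Fin 2, ∑ b : Fin 2, π.mkQ (π.lieDerivW (Rat.lieOfReal hcpt (Matrix.single a b (1 : ℝ)))
        (π.lieDerivW (Rat.lieOfReal hcpt (Matrix.single b a (1 : ℝ))) ⟨φ, hφ⟩))) =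
        π.mkQ (∑ a : Fin 2, ∑ b : Fin 2, π.lieDerivW (Rat.lieOfReal hcpt (Matrix.single a b (1 : ℝ)))
          (π.lieDerivW (Rat.lieOfReal hcpt (Matrix.single b a (1 : ℝ))) ⟨φ, hφ⟩)) := by
      simp only [map_sum]
    rw [hsum, ← map_smul]
    congr 1
    apply Subtype.ext
    rw [Submodule.coe_sum, Submodule.coe_smul]
    simp only [Submodule.coe_sum, hcoe]
    exact hC
  exact GL2Casimir.hasHCParameter_of_lift_casimir_of_lift_zed hθ₁' hv0 hC' hZ'

/-- **The archimedean parameter of the cuspidal datum generated by a Casimir eigenform on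
`GL₂(𝔸_ℚ)`** (the dictionary step "eigenform of weight `k` ↦ `π` with Harish-Chandra parameter
`{(k-1)/2, (1-k)/2}`" read on the GENERATED datum, by cyclicity — no Schur lemma, no admissibility):
if `0 ≠ φ ∈ 𝒜₀(GL₂)` satisfies along `ι_𝔸` the eigen-equations
`∑_{a,b} E_{ab}(E_{ba} φ) = (s₁² + s₂² - ½) φ` and `Z φ = (s₁ + s₂) φ`, then
`CuspidalAutomorphicRepData.ofCuspForm hφ hφ0` has archimedean parameter `{s₁, s₂}`
(`Rat.hasZCharacter_of_casimir_of_zed` ⟹ `hasInfinitesimalCharacter_lieRep_ofCuspForm` ⟹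
`hasArchParameter_of_hasInfinitesimalCharacter_of_casimir_of_zed`). Gelbart 1975, §4 and Thm. 5.19;
Bump 1997, §2.2 and Thm. 3.6.1; Knapp 2002, Thm. 5.44.
[cite: Gelbart1975, Thm. 5.19] [cite: Knapp2002, §V.5 Thm. 5.44 and Prop. 5.32] -/
theorem CuspidalAutomorphicRepData.hasArchParameter_ofCuspForm_of_casimir_of_zed
    {φ : (AdelicGroupData.gl 2 ℚ).Adelic → ℂ} (hφ : φ ∈ cuspFormsGL 2 ℚ hcpt) (hφ0 : φ ≠ 0) {s₁ s₂ : ℂ}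
    (hC : (∑ a : Fin 2, ∑ b : Fin 2, lieDeriv Rat.iotaA (toLie (Matrix.single a b (1 : ℝ)))
        (lieDeriv Rat.iotaA (toLie (Matrix.single b a (1 : ℝ))) φ)) = (s₁ ^ 2 + s₂ ^ 2 - 1 / 2) • φ)
    (hZ : lieDeriv Rat.iotaA (toLie 1) φ = (s₁ + s₂) • φ) :
    (CuspidalAutomorphicRepData.ofCuspForm hφ hφ0).1.HasArchParameter fun _ => ({s₁, s₂} : Multiset ℂ) := by
  have hφs : IsArchSmooth (AutomorphyDatum.gl 2 ℚ hcpt).ofArch φ :=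
    automorphicForms_le_archSmooth _ (cuspFormsGL_le_automorphicForms 2 ℚ hcpt hφ)
  obtain ⟨θ, hθ⟩ := Rat.hasZCharacter_of_casimir_of_zed hφs hC hZ
  exact (CuspidalAutomorphicRepData.ofCuspForm hφ hφ0).1.hasArchParameter_of_hasInfinitesimalCharacter_of_casimir_of_zed
    (CuspidalAutomorphicRepData.hasInfinitesimalCharacter_lieRep_ofCuspForm hφ hφ0 hθ)
    (CuspidalAutomorphicRepData.mem_W_ofCuspForm hφ hφ0)
    (CuspidalAutomorphicRepData.not_mem_W'_ofCuspForm hφ hφ0) hC hZ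

end GL2Rat

end Literature.NumberTheory.Automorphic
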